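import Literature.MathematicalPhysics.QuantumFieldTheory.Balaban1983to89.LatticeWordStokes
import HarnessLib

/-!
# `Balaban1983to89.LatticeWordStokesLocal` — the crude non-abelian lattice Stokes bound of `LatticeWordStokes` with a LOCAL
# hypothesis: only the plaquettes based at sites reachable from the base with the word's own letters need be small

Cell `ym3-torus` (rung R3), seat `ym3-torus-p2` gen 12; OWNER RULING g18-№3 §5 (target «LOCAL [B7] Prop. 1 for `blockAvg ℰp`»), alpha-1's spec
(fleet INBOX 06:07:26Z): the large-field bookkeeping of [Balaban1985UV3] (38)–(41) needs «averages of small fields are small» for fields that are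
small only ON A REGION (the window `χ_{k+1}` sits on `Ω_{k+1}`, (39)–(40) p.266); the tree's `LatticeWordStokes.dist1_holAt_le` and hence
`BlockAveragingPlaquetteBound.plaqSmall_blockAvg_expMeanLogSU` assume `PlaqSmall δ U` on the WHOLE torus.

THE LOCALISATION.  The swap ∕ cancellation calculus of `LatticeWordStokes` (§2–§4 there) rearranges the letters of the word `w` read from `x`;
every intermediate word uses each letter `±e_μ` at most as often as `w` does, so every site it visits is `walkEnd x u` for a word `u` with
`u.count l ≤ w.count l` for all letters `l` (the COUNT BOX of `w` at `x`), and every plaquette whose smallness is used (the plaquette at `y`,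
`y − e_a`, `y − e_b` or `y − e_a − e_b`, `y` the current position, `±e_a, ±e_b` the two letters being exchanged) is based at such a site.  Hence:
* §1 `dist1_swapDefect_le_local`, `dist1_holAt_swap_le_local`, `dist1_holAt_cancel_le_local` — the three steps under the hypothesis
  «every plaquette based in the count box of the budget word `W` is within `δ` of `1`»;
* §2 **`dist1_holAt_le_local`**: `|𝒰_x(w) − 1| ≤ (|w|²/4)·δ` for every closed word `w`, assuming ONLY
  `∀ u, (∀ l, u.count l ≤ w.count l) → ∀ a < b, dist1 U(∂⟨walkEnd x u, a, b⟩) < δ`.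
The numerical constants are those of `LatticeWordStokes` (nothing sharper is attempted).  No `sorry`, no `def`; [folklore] lattice bookkeeping
around [Balaban1985Averaging] (19)–(20).  The application to the (0.4) loop words and to [Balaban1985Averaging] Prop. 1 in local form is the sibling
module `BlockAveragingPlaquetteBoundLocal`.

References: T. Bałaban, CMP 98 (1985) 17–51 [Balaban1985Averaging] ((9) p.19, (19)–(20) p.21); CMP 109 (1987) 249–301 [Balaban1987RG1] ((0.4) p.253);
CMP 102 (1985) 255–275 [Balaban1985UV3] ((39)–(40) p.266: the regions on which fields are small).
-/

namespace Literature.MathematicalPhysics.QuantumFieldTheory.Balaban1983to89.LatticeWordStokesLocal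

open T4Continuum T4ReflectionCone LatticeWordStokes

variable {P : Params} {j : ℕ} {G : Type*} [GaugeGroup G]

/-! ## §0 Site arithmetic (the private lemmas of `LatticeWordStokes` §1, re-proved) -/

section Sites

/-- `(x − e_a) + e_a = x`. [folklore] -/
private theorem shift_unshift (x : Site P j) (a : Fin P.d) : (x.unshift a).shift a = x := by
  funext i
  by_cases h : i = a
  · subst h; simp [Site.shift, Site.unshift]
  · simp [Site.shift, Site.unshift, h]

/-- `(x − e_a) − e_b = (x − e_b) − e_a`. [folklore] -/
private theorem unshift_unshift_comm (x : Site P j) (a b : Fin P.d) : (x.unshift a).unshift b = (x.unshift b).unshift a := by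
  funext i
  by_cases ha : i = a <;> by_cases hb : i = b
  · subst ha; subst hb; rfl
  · subst ha; simp [Site.unshift, hb]
  · subst hb; simp [Site.unshift, ha]
  · simp [Site.unshift, ha, hb]

/-- `(x + e_a) − e_b = (x − e_b) + e_a`. [folklore] -/
private theorem shift_unshift_comm (x : Site P j) (a b : Fin P.d) : (x.shift a).unshift b = (x.unshift b).shift a := by
  by_cases hab : a = b
  · subst hab
    rw [shift_unshift]
    funext i
    by_cases h : i = a
    · subst h; simp [Site.shift, Site.unshift]
    · simp [Site.shift, Site.unshift, h]
  funext i
  by_cases ha : i = a <;> by_cases hb : i = b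
  · exact absurd (ha.symm.trans hb) hab
  · subst ha; simp [Site.shift, Site.unshift, hb]
  · subst hb; simp [Site.shift, Site.unshift, ha]
  · simp [Site.shift, Site.unshift, ha, hb]

end Sites

/-! ## §1 The three steps of `LatticeWordStokes` under the count-box hypothesis -/

section Steps

variable (U : GaugeField P j G)

/-- **THE COMMUTATOR DEFECT, ORDERED NON-PARALLEL CASE, LOCAL FORM** (`a < b`): `|𝒰_y((a,s)(b,t))·𝒰_y((b,t)(a,s))⁻¹ − 1| < δ` as soon as
the plaquettes `⟨walkEnd y u, a, b⟩` with `u` using at most the letters `(a,s), (b,t)` are within `δ` of `1` (the defect is a conjugate of the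
plaquette variable at `y`, `y − e_a`, `y − e_b` or `y − e_a − e_b`, or of its inverse). [cite: Balaban1985Averaging, (9) p.19 and (19)-(20) p.21] -/
theorem dist1_swapDefect_lt_of_lt_local {δ : ℝ} (y : Site P j) {a b : Fin P.d} (hab : a < b) (s t : Bool)
    (hloc : ∀ u : List (Letter P.d), (∀ l, u.count l ≤ [(a, s), (b, t)].count l) →
      dist1 (GaugeField.plaqHol U ⟨walkEnd y u, a, b, hab⟩) < δ) :
    dist1 (holAt U (walk y [(a, s), (b, t)]) * (holAt U (walk y [(b, t), (a, s)]))⁻¹) < δ := by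
  cases s <;> cases t
  · -- (−a, −b): plaquette at z = y − a − b = walkEnd y [(a,false),(b,false)]
    have hp : dist1 (GaugeField.plaqHol U ⟨(y.unshift a).unshift b, a, b, hab⟩) < δ :=
      hloc [(a, false), (b, false)] fun l => le_rfl
    refine dist1_conj_lt (U ⟨(y.unshift a).unshift b, a⟩ * U ⟨((y.unshift a).unshift b).shift a, b⟩)⁻¹ hp (Or.inl ?_)
    rw [holAt_walk_ff, holAt_walk_ff]
    simp only [GaugeField.plaqHol]
    rw [unshift_unshift_comm y b a, shift_unshift _, show ((y.unshift a).unshift b).shift a = y.unshift b by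
      rw [unshift_unshift_comm, shift_unshift]]
    group
  · -- (−a, +b): plaquette at z = y − a = walkEnd y [(a,false)]
    have hsub : ([(a, false)] : List (Letter P.d)).Sublist [(a, false), (b, true)] :=
      List.Sublist.cons_cons _ (List.nil_sublist _)
    have hp : dist1 (GaugeField.plaqHol U ⟨y.unshift a, a, b, hab⟩) < δ :=
      hloc [(a, false)] fun l => hsub.count_le l
    refine dist1_conj_lt (U ⟨y.unshift a, a⟩)⁻¹ hp (Or.inr ?_)
    rw [holAt_walk_ft, holAt_walk_tf]
    simp only [GaugeField.plaqHol]
    rw [shift_unshift, shift_unshift_comm y b a]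
    group
  · -- (+a, −b): plaquette at z = y − b = walkEnd y [(b,false)]
    have hsub : ([(b, false)] : List (Letter P.d)).Sublist [(a, true), (b, false)] :=
      List.Sublist.cons _ (List.Sublist.refl _)
    have hp : dist1 (GaugeField.plaqHol U ⟨y.unshift b, a, b, hab⟩) < δ :=
      hloc [(b, false)] fun l => hsub.count_le l
    refine dist1_conj_lt (U ⟨y.unshift b, b⟩)⁻¹ hp (Or.inr ?_)
    rw [holAt_walk_tf, holAt_walk_ft]
    simp only [GaugeField.plaqHol]
    rw [shift_unshift, shift_unshift_comm y a b]
    group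
  · -- (+a, +b): the plaquette at y itself = walkEnd y []
    have hp : dist1 (GaugeField.plaqHol U ⟨y, a, b, hab⟩) < δ :=
      hloc [] fun l => by simp
    refine dist1_conj_lt 1 hp (Or.inl ?_)
    rw [holAt_walk_tt, holAt_walk_tt]
    simp only [GaugeField.plaqHol]
    group

/-- The defect of `(m₂, m₁)` is the inverse of the defect of `(m₁, m₂)`. [folklore] -/
private theorem swapDefect_symm (y : Site P j) (m₁ m₂ : Letter P.d) :
    holAt U (walk y [m₂, m₁]) * (holAt U (walk y [m₁, m₂]))⁻¹ = (holAt U (walk y [m₁, m₂]) * (holAt U (walk y [m₂, m₁]))⁻¹)⁻¹ := by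
  group

/-- **THE COMMUTATOR DEFECT OF ANY TWO LETTERS, LOCAL FORM**: `|𝒰_y(m₁m₂)·𝒰_y(m₂m₁)⁻¹ − 1| ≤ δ` (`δ ≥ 0`) as soon as every plaquette
`⟨walkEnd y u, a, b⟩` with `u` using at most the letters `m₁, m₂` is within `δ` of `1`. [cite: Balaban1985Averaging, (9) p.19 and (19)-(20) p.21] -/
theorem dist1_swapDefect_le_local {δ : ℝ} (hδ : 0 ≤ δ) (y : Site P j) (m₁ m₂ : Letter P.d)
    (hloc : ∀ u : List (Letter P.d), (∀ l, u.count l ≤ [m₁, m₂].count l) →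
      ∀ (a b : Fin P.d) (hab : a < b), dist1 (GaugeField.plaqHol U ⟨walkEnd y u, a, b, hab⟩) < δ) :
    dist1 (holAt U (walk y [m₁, m₂]) * (holAt U (walk y [m₂, m₁]))⁻¹) ≤ δ := by
  obtain ⟨a, s⟩ := m₁
  obtain ⟨b, t⟩ := m₂
  rcases lt_trichotomy a b with hab | rfl | hba
  · exact (dist1_swapDefect_lt_of_lt_local U y hab s t (fun u hu => hloc u hu a b hab)).le
  · rw [swapDefect_eq_one_of_parallel, GaugeGroup.dist1_one]; exact hδ
  · rw [← inv_inv (holAt U (walk y [(a, s), (b, t)]) * (holAt U (walk y [(b, t), (a, s)]))⁻¹), GaugeGroup.dist1_inv,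
      ← swapDefect_symm]
    have hperm : ([(b, t), (a, s)] : List (Letter P.d)).Perm [(a, s), (b, t)] := List.Perm.swap _ _ _
    exact (dist1_swapDefect_lt_of_lt_local U y hba t s
      (fun u hu => hloc u (fun l => (hu l).trans_eq (hperm.count_eq l)) b a hba)).le

/-- **AN ADJACENT TRANSPOSITION COSTS AT MOST `δ`, LOCAL FORM**: for the word `A ++ m₁ :: m₂ :: C` read from `x`,
`|𝒰_x(A m₁ m₂ C) − 1| ≤ δ + |𝒰_x(A m₂ m₁ C) − 1|` as soon as every plaquette `⟨walkEnd x u, a, b⟩` with `u.count ≤ (A ++ [m₁, m₂]).count` is within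
`δ ≥ 0` of `1`. [cite: Balaban1985Averaging, (19)-(20) p.21] -/
theorem dist1_holAt_swap_le_local {δ : ℝ} (hδ : 0 ≤ δ) (x : Site P j) (A C : List (Letter P.d)) (m₁ m₂ : Letter P.d)
    (hloc : ∀ u : List (Letter P.d), (∀ l, u.count l ≤ (A ++ [m₁, m₂]).count l) →
      ∀ (a b : Fin P.d) (hab : a < b), dist1 (GaugeField.plaqHol U ⟨walkEnd x u, a, b, hab⟩) < δ) :
    dist1 (holAt U (walk x (A ++ m₁ :: m₂ :: C))) ≤ δ + dist1 (holAt U (walk x (A ++ m₂ :: m₁ :: C))) := by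
  rw [holAt_walk_swap_eq U x A C m₁ m₂]
  refine (GaugeGroup.dist1_mul_le _ _).trans ?_
  rw [GaugeGroup.dist1_conj]
  refine add_le_add (dist1_swapDefect_le_local U hδ _ m₁ m₂ fun u hu a b hab => ?_) le_rfl
  rw [← walkEnd_append]
  refine hloc (A ++ u) (fun l => ?_) a b hab
  rw [List.count_append, List.count_append]
  exact Nat.add_le_add_left (hu l) _

/-- **MOVING `m̄` LEFTWARD THROUGH `B` TO ITS PARTNER `m` COSTS `|B|` PLAQUETTES, LOCAL FORM**: for the word `A m B m̄ C` read from `x`,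
`|𝒰_x(A m B m̄ C) − 1| ≤ |B|·δ + |𝒰_x(A B C) − 1|` as soon as every plaquette `⟨walkEnd x u, a, b⟩` with `u.count ≤ (A m B m̄ C).count` is within
`δ ≥ 0` of `1`. [cite: Balaban1985Averaging, (19)-(20) p.21] -/
theorem dist1_holAt_cancel_le_local {δ : ℝ} (hδ : 0 ≤ δ) (x : Site P j) (m : Letter P.d) :
    ∀ (B A C : List (Letter P.d)),
      (∀ u : List (Letter P.d), (∀ l, u.count l ≤ (A ++ m :: (B ++ m.flip :: C)).count l) →
        ∀ (a b : Fin P.d) (hab : a < b), dist1 (GaugeField.plaqHol U ⟨walkEnd x u, a, b, hab⟩) < δ) →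
      dist1 (holAt U (walk x (A ++ m :: (B ++ m.flip :: C)))) ≤ (B.length : ℝ) * δ + dist1 (holAt U (walk x (A ++ (B ++ C))))
  | [], A, C, _ => by
    simp only [List.nil_append, List.length_nil, Nat.cast_zero, zero_mul, zero_add]
    rw [holAt_walk_backtrack]
  | b :: B, A, C, hloc => by
    have h₁ : A ++ b :: m :: (B ++ m.flip :: C) = (A ++ [b]) ++ m :: (B ++ m.flip :: C) := by simp
    have h₂ : A ++ (b :: B ++ C) = (A ++ [b]) ++ (B ++ C) := by simp
    -- the budget of the swapped word `A b m (B m̄ C)` equals the budget of the current word (a permutation)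
    have hperm : (A ++ b :: m :: (B ++ m.flip :: C)).Perm (A ++ m :: (b :: B ++ m.flip :: C)) :=
      List.Perm.append_left A (List.Perm.swap m b _)
    have hloc_swap : ∀ u : List (Letter P.d), (∀ l, u.count l ≤ (A ++ [m, b]).count l) →
        ∀ (a b' : Fin P.d) (hab : a < b'), dist1 (GaugeField.plaqHol U ⟨walkEnd x u, a, b', hab⟩) < δ := by
      intro u hu a b' hab
      refine hloc u (fun l => (hu l).trans ?_) a b' hab
      have hsub : (A ++ [m, b]).Sublist (A ++ m :: (b :: B ++ m.flip :: C)) :=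
        (List.Sublist.refl A).append (List.Sublist.cons_cons _ (List.Sublist.cons_cons _ (List.nil_sublist _)))
      exact hsub.count_le l
    have hloc_rec : ∀ u : List (Letter P.d), (∀ l, u.count l ≤ ((A ++ [b]) ++ m :: (B ++ m.flip :: C)).count l) →
        ∀ (a b' : Fin P.d) (hab : a < b'), dist1 (GaugeField.plaqHol U ⟨walkEnd x u, a, b', hab⟩) < δ := by
      intro u hu a b' hab
      refine hloc u (fun l => (hu l).trans_eq ?_) a b' hab
      rw [← h₁]
      exact hperm.count_eq l
    calc dist1 (holAt U (walk x (A ++ m :: (b :: B ++ m.flip :: C))))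
        ≤ δ + dist1 (holAt U (walk x (A ++ b :: m :: (B ++ m.flip :: C)))) := dist1_holAt_swap_le_local U hδ x A _ m b hloc_swap
      _ ≤ δ + ((B.length : ℝ) * δ + dist1 (holAt U (walk x (A ++ (b :: B ++ C))))) := by
          rw [h₁, h₂]
          exact add_le_add le_rfl (dist1_holAt_cancel_le_local hδ x m B (A ++ [b]) C hloc_rec)
      _ = ((b :: B).length : ℝ) * δ + dist1 (holAt U (walk x (A ++ (b :: B ++ C)))) := by
          simp only [List.length_cons, Nat.cast_succ]
          ring

end Steps

/-! ## §2 The local bound for closed words -/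

section Main

variable (U : GaugeField P j G)

/-- A word with positive net displacement in direction `a` contains the letter `+e_a`; with negative, the letter `−e_a`. [folklore] -/
private theorem mem_of_netDisp_ne (a : Fin P.d) : ∀ (w : List (Letter P.d)),
    (0 < netDisp w a → (a, true) ∈ w) ∧ (netDisp w a < 0 → (a, false) ∈ w)
  | [] => by simp [netDisp]
  | l :: w => by
    obtain ⟨hpos, hneg⟩ := mem_of_netDisp_ne a w
    obtain ⟨b, s⟩ := l
    constructor
    · intro h
      rw [netDisp_cons] at h
      by_cases hb : b = a
      · subst hb
        cases s
        · exact List.mem_cons_of_mem _ (hpos (by simp at h; linarith))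
        · exact List.mem_cons_self
      · exact List.mem_cons_of_mem _ (hpos (by simp [hb] at h; exact h))
    · intro h
      rw [netDisp_cons] at h
      by_cases hb : b = a
      · subst hb
        cases s
        · exact List.mem_cons_self
        · exact List.mem_cons_of_mem _ (hneg (by simp at h; linarith))
      · exact List.mem_cons_of_mem _ (hneg (by simp [hb] at h; exact h))

/-- The tail of a closed word beginning with `m` contains `m̄`. [folklore] -/
private theorem flip_mem_of_netDisp_eq_zero (m : Letter P.d) (w : List (Letter P.d)) (h : netDisp (m :: w) m.1 = 0) : m.flip ∈ w := by
  obtain ⟨a, s⟩ := m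
  rw [netDisp_cons] at h
  simp only [if_true] at h
  cases s
  · exact (mem_of_netDisp_ne a w).1 (by simp at h; linarith)
  · exact (mem_of_netDisp_ne a w).2 (by simp at h; linarith)

/-- Removing a cancelling pair `m … m̄` keeps every net displacement. [folklore] -/
private theorem netDisp_remove_pair (m : Letter P.d) (B C : List (Letter P.d)) (ν : Fin P.d) :
    netDisp (m :: (B ++ m.flip :: C)) ν = netDisp (B ++ C) ν := by
  obtain ⟨a, s⟩ := m
  simp only [netDisp_cons, netDisp_append, Letter.flip]
  by_cases ha : a = ν
  · subst ha; cases s <;> simp <;> ring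
  · simp [ha]

/-- **THE CRUDE NON-ABELIAN LATTICE STOKES BOUND, LOCAL FORM.**  Fix a base site `x`, a budget word `W` and `δ ≥ 0`, and suppose every plaquette
`⟨walkEnd x u, a, b⟩` based at the end of a walk `u` using each letter at most as often as `W` does is within `δ` of `1`.  Then for every word
`w` within the budget (`w.count ≤ W.count`) with zero net displacement in every direction, `|𝒰_x(w) − 1| ≤ (|w|²/4)·δ` — the induction of
`LatticeWordStokes.dist1_holAt_le_of_netDisp_eq_zero`, all of whose intermediate words stay within the budget. [cite: Balaban1985Averaging, (9) p.19 and (19)-(20) p.21] -/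
theorem dist1_holAt_le_of_netDisp_eq_zero_local {δ : ℝ} (hδ : 0 ≤ δ) (x : Site P j) (W : List (Letter P.d))
    (hloc : ∀ u : List (Letter P.d), (∀ l, u.count l ≤ W.count l) →
      ∀ (a b : Fin P.d) (hab : a < b), dist1 (GaugeField.plaqHol U ⟨walkEnd x u, a, b, hab⟩) < δ) :
    ∀ (n : ℕ) (w : List (Letter P.d)), w.length = n → (∀ l, w.count l ≤ W.count l) → (∀ ν, netDisp w ν = 0) →
      dist1 (holAt U (walk x w)) ≤ ((n : ℝ) ^ 2 / 4) * δ := by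
  intro n
  induction n using Nat.strong_induction_on with
  | _ n ih =>
    intro w hlen hbud hnull
    cases w with
    | nil =>
      subst hlen
      simp only [walk, holAt_nil, GaugeGroup.dist1_one]
      positivity
    | cons m w' =>
      have hmem : m.flip ∈ w' := flip_mem_of_netDisp_eq_zero m w' (hnull m.1)
      obtain ⟨B, C, hw'⟩ := List.append_of_mem hmem
      subst hw'
      have hloc' : ∀ u : List (Letter P.d), (∀ l, u.count l ≤ ([] ++ m :: (B ++ m.flip :: C)).count l) →
          ∀ (a b : Fin P.d) (hab : a < b), dist1 (GaugeField.plaqHol U ⟨walkEnd x u, a, b, hab⟩) < δ :=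
        fun u hu a b hab => hloc u (fun l => (hu l).trans (by simpa using hbud l)) a b hab
      have hstep := dist1_holAt_cancel_le_local U hδ x m B [] C hloc'
      simp only [List.nil_append] at hstep
      have hnull' : ∀ ν, netDisp (B ++ C) ν = 0 := fun ν => by rw [← netDisp_remove_pair m B C ν]; exact hnull ν
      have hsub : (B ++ C).Sublist (m :: (B ++ m.flip :: C)) :=
        (((List.Sublist.refl B).append (List.sublist_cons_self m.flip C))).trans (List.sublist_cons_self m _)
      have hbud' : ∀ l, (B ++ C).count l ≤ W.count l := fun l => (hsub.count_le l).trans (hbud l)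
      simp only [List.length_cons, List.length_append] at hlen
      have hlen' : (B ++ C).length = n - 2 := by simp; omega
      have h2n : 2 ≤ n := by omega
      have ih' := ih (n - 2) (by omega) (B ++ C) hlen' hbud' hnull'
      have hB : (B.length : ℝ) ≤ (n : ℝ) - 2 := by
        have h : (B.length : ℝ) + 2 ≤ n := by exact_mod_cast (show B.length + 2 ≤ n by omega)
        linarith
      have hcast : (((n - 2 : ℕ) : ℝ)) = (n : ℝ) - 2 := by rw [Nat.cast_sub h2n]; norm_num
      calc dist1 (holAt U (walk x (m :: (B ++ m.flip :: C))))
          ≤ (B.length : ℝ) * δ + dist1 (holAt U (walk x (B ++ C))) := hstep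
        _ ≤ ((n : ℝ) - 2) * δ + ((((n - 2 : ℕ) : ℝ)) ^ 2 / 4) * δ := add_le_add (mul_le_mul_of_nonneg_right hB hδ) ih'
        _ ≤ ((n : ℝ) ^ 2 / 4) * δ := by rw [hcast]; nlinarith

/-- **LOCAL STOKES, the word's own budget**: if every plaquette `⟨walkEnd x u, a, b⟩` with `u.count ≤ w.count` is within `δ ≥ 0` of `1` and `w`
has zero net displacement in every direction, then `|𝒰_x(w) − 1| ≤ (|w|²/4)·δ`. [cite: Balaban1985Averaging, (9) p.19 and (19)-(20) p.21] -/
theorem dist1_holAt_le_local {δ : ℝ} (hδ : 0 ≤ δ) (x : Site P j) (w : List (Letter P.d))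
    (hloc : ∀ u : List (Letter P.d), (∀ l, u.count l ≤ w.count l) →
      ∀ (a b : Fin P.d) (hab : a < b), dist1 (GaugeField.plaqHol U ⟨walkEnd x u, a, b, hab⟩) < δ)
    (hw : ∀ ν, netDisp w ν = 0) : dist1 (holAt U (walk x w)) ≤ ((w.length : ℝ) ^ 2 / 4) * δ :=
  dist1_holAt_le_of_netDisp_eq_zero_local U hδ x w hloc w.length w rfl (fun _ => le_rfl) hw

end Main

end Literature.MathematicalPhysics.QuantumFieldTheory.Balaban1983to89.LatticeWordStokesLocal
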